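import Summits.NavierStokesRegularity.NavierStokesRegularity.Theorems.GaldiLiouvilleGateGaldiLiouvilleDriftMaximumPrinciple
import Literature.Analysis.FluidPDE.TsaiHeadPressureIdentity
import Literature.Analysis.FluidPDE.VectorCalculus
import HarnessLib

/-!
# GaldiLiouvilleGateGaldiLiouvilleHeadMaximumPrinciple — census row S1 ⟨0895⟩ `GaldiLiouville`, line «allaxes»
# (ns-idea-4 g8): support O1b″ — the HEAD MAXIMUM PRINCIPLE given the pressure limit at infinity

Support O1b of the combined Defs of record (ns-idea-4, `lines/combined/CylinderBudgets_v3_1.lean`,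
`AllAxesBudget.HeadMaximumPrinciple`) reads: for every smooth D-solution `(U, P)` of the steady Navier–Stokes system
on `ℝ³` (NO symmetry: `IsLerayProfile ν 0 U P`, `U, P ∈ C^∞`, finite Dirichlet integral, `U → 0` at infinity) the
pressure has a limit `c` at infinity AND the Bernoulli head obeys `P + ‖U‖²/2 ≤ c` everywhere.  The director's cut
(DIRECTOR-NS #210 (4) / #214 (2)) splits it into O1b′ = the pressure limit (a Literature fact, Galdi 2011 Thm X.5.1,
filed by ns-in-wu-p33 g2) and **O1b″ = this file: GIVEN `P → c` at infinity, `P + ‖U‖²/2 ≤ c`**, in the GENERAL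
all-axes form (no symmetry), with the files-only bundle `IsDSolution` unfolded verbatim.

Proof (M on paper, S in the tree): the head pressure `Θ = ½‖U‖² + P` (`Literature…headPressure 0 U P`) of a smooth
Leray profile at rate `a = 0` is a SUBSOLUTION of Tsai's drift–Laplace operator, `νΔΘ − U·∇Θ = ν‖curl U‖² ≥ 0`
(Tsai 1998 (1.7) = tree `IsLerayProfile.driftOp_headPressure_nonneg`); `U` is bounded (continuous, `→ 0` at
infinity) and `Θ → ½·0 + c = c` at infinity; the perturbed weak maximum principle on large balls, landed for this
lane by ns-s29-p2 g3 (`…GaldiLiouvilleDriftMaximumPrinciple.le_of_driftOp_nonneg_of_tendsto`), gives `Θ ≤ c`.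
The finite-Dirichlet-integral clause of the bundle is carried, not used.

* `head_le_of_tendsto_pressure` — O1b″ with the bundle unfolded;
* `headMaximumPrinciple_of_pressureLimit` — O1b (= `AllAxesBudget.HeadMaximumPrinciple`, bundle unfolded) from any
  proof of O1b′ (`∀ D-solutions, ∃ c, P → c`), by `exact`.

Seat ns-in-wu-con g2 (DIRECTOR-NS #214 (2); lane arbiter ns-in-ser-a g2; critic idea-crit-3).  WHAT THIS IS NOT:
elliptic bookkeeping for a support of an OPEN route item; nothing about ⟨0895⟩ `GaldiLiouville` (Galdi's Liouville
problem), census row S1 or Navier–Stokes regularity is proved here.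
-/

noncomputable section

-- the summit and its single sub-problem share the name (CONVENTIONS §1), as in every Theorems file
set_option linter.dupNamespace false

namespace Summit.NavierStokesRegularity.NavierStokesRegularity.Theorems.GaldiLiouville.AllAxesBudget

open MeasureTheory Set Filter Topology Function Metric
open scoped ENNReal InnerProductSpace RealInnerProductSpace
open Literature.Analysis.FluidPDE

/-- **O1b″ — the head maximum principle given the pressure limit** (general steady Navier–Stokes on `ℝ³`, any
symmetry): for a smooth D-solution `(U, P)` tending to `0` at infinity whose pressure tends to `c` at infinity,
`P + ‖U‖²/2 ≤ c` everywhere (Tsai's head-pressure identity `νΔΘ − U·∇Θ = ν‖curl U‖² ≥ 0` + the perturbed weak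
maximum principle on large balls).  The bundle is `AllAxesBudget.IsDSolution` unfolded verbatim; its Dirichlet
clause is not used. [cite: Tsai1998, (1.7); GilbargTrudinger2001, §3.1] -/
theorem head_le_of_tendsto_pressure :
    ∀ ν : ℝ, 0 < ν → ∀ (U : EuclideanSpace ℝ (Fin 3) → EuclideanSpace ℝ (Fin 3)) (P : EuclideanSpace ℝ (Fin 3) → ℝ),
      (IsLerayProfile ν 0 U P ∧ ContDiff ℝ (⊤ : ℕ∞) U ∧ ContDiff ℝ (⊤ : ℕ∞) P ∧
        (∫⁻ y, ENNReal.ofReal (frobeniusNormSq (fderiv ℝ U y))) < ⊤ ∧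
        Tendsto U (cocompact (EuclideanSpace ℝ (Fin 3))) (𝓝 0)) →
      ∀ c : ℝ, Tendsto P (cocompact (EuclideanSpace ℝ (Fin 3))) (𝓝 c) →
        ∀ x, P x + ‖U x‖ ^ 2 / 2 ≤ c := by
  intro ν hν U P hsol c hPlim x
  obtain ⟨hprof, hU, -, -, hlim⟩ := hsol
  have hUc : Continuous U := hU.continuous
  -- the head pressure at rate `a = 0`
  set Θ : EuclideanSpace ℝ (Fin 3) → ℝ := headPressure 0 U P with hΘ_def
  have hΘapp : ∀ y, Θ y = 2⁻¹ * ‖U y‖ ^ 2 + P y := by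
    intro y
    rw [hΘ_def, headPressure_apply, zero_mul, add_zero]
  have hΘ2 : ContDiff ℝ 2 Θ := contDiff_infty.1 (hprof.contDiff_headPressure hU) 2
  have hLΘ : ∀ y, 0 ≤ driftOp ν 0 U Θ y := fun y => hprof.driftOp_headPressure_nonneg hU hν.le y
  -- `U` is bounded (continuous and `→ 0` at infinity)
  obtain ⟨M, hM⟩ : ∃ M : ℝ, ∀ y, ‖U y‖ ≤ M := by
    have h1 : ∀ᶠ y in cocompact (EuclideanSpace ℝ (Fin 3)), ‖U y‖ < 1 := by
      have h := hlim (Metric.ball_mem_nhds (0 : EuclideanSpace ℝ (Fin 3)) one_pos)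
      filter_upwards [h] with y hy
      simpa using hy
    obtain ⟨K, hK, hKfar⟩ := (hasBasis_cocompact.eventually_iff).1 h1
    obtain ⟨M₁, hM₁⟩ := hK.exists_bound_of_continuousOn hUc.continuousOn
    refine ⟨max M₁ 1, fun y => ?_⟩
    by_cases hy : y ∈ K
    · exact (hM₁ y hy).trans (le_max_left _ _)
    · exact ((hKfar hy).le).trans (le_max_right _ _)
  -- `Θ → c` at infinity
  have hΘlim : Tendsto Θ (cocompact (EuclideanSpace ℝ (Fin 3))) (𝓝 c) := by
    have h1 : Tendsto (fun y => ‖U y‖) (cocompact (EuclideanSpace ℝ (Fin 3))) (𝓝 0) := by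
      simpa using hlim.norm
    have h2 : Tendsto (fun y => 2⁻¹ * ‖U y‖ ^ 2 + P y) (cocompact (EuclideanSpace ℝ (Fin 3)))
        (𝓝 (2⁻¹ * (0 : ℝ) ^ 2 + c)) := ((h1.pow 2).const_mul _).add hPlim
    rw [show (2⁻¹ * (0 : ℝ) ^ 2 + c) = c by ring] at h2
    exact h2.congr' (Eventually.of_forall fun y => (hΘapp y).symm)
  have hle := le_of_driftOp_nonneg_of_tendsto hν hM hΘ2 hLΘ hΘlim x
  rw [hΘapp x] at hle
  linarith

/-- **O1b from O1b′.**  The support `HeadMaximumPrinciple` of the combined Defs (bundle unfolded verbatim: a pressure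
limit at infinity exists AND the head is bounded by it) follows from any proof of O1b′ «the pressure of a smooth
D-solution has a limit at infinity» (Galdi 2011, Thm X.5.1 — a Literature fact, filed separately), by
`head_le_of_tendsto_pressure`. [cite: Galdi2011, Thm X.5.1; Tsai1998, (1.7)] -/
theorem headMaximumPrinciple_of_pressureLimit
    (hlimit : ∀ ν : ℝ, 0 < ν → ∀ (U : EuclideanSpace ℝ (Fin 3) → EuclideanSpace ℝ (Fin 3))
      (P : EuclideanSpace ℝ (Fin 3) → ℝ),
      (IsLerayProfile ν 0 U P ∧ ContDiff ℝ (⊤ : ℕ∞) U ∧ ContDiff ℝ (⊤ : ℕ∞) P ∧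
        (∫⁻ y, ENNReal.ofReal (frobeniusNormSq (fderiv ℝ U y))) < ⊤ ∧
        Tendsto U (cocompact (EuclideanSpace ℝ (Fin 3))) (𝓝 0)) →
      ∃ c : ℝ, Tendsto P (cocompact (EuclideanSpace ℝ (Fin 3))) (𝓝 c)) :
    ∀ ν : ℝ, 0 < ν → ∀ (U : EuclideanSpace ℝ (Fin 3) → EuclideanSpace ℝ (Fin 3)) (P : EuclideanSpace ℝ (Fin 3) → ℝ),
      (IsLerayProfile ν 0 U P ∧ ContDiff ℝ (⊤ : ℕ∞) U ∧ ContDiff ℝ (⊤ : ℕ∞) P ∧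
        (∫⁻ y, ENNReal.ofReal (frobeniusNormSq (fderiv ℝ U y))) < ⊤ ∧
        Tendsto U (cocompact (EuclideanSpace ℝ (Fin 3))) (𝓝 0)) →
      ∃ c : ℝ, Tendsto P (cocompact (EuclideanSpace ℝ (Fin 3))) (𝓝 c) ∧ ∀ x, P x + ‖U x‖ ^ 2 / 2 ≤ c := by
  intro ν hν U P hsol
  obtain ⟨c, hc⟩ := hlimit ν hν U P hsol
  exact ⟨c, hc, head_le_of_tendsto_pressure ν hν U P hsol c hc⟩

end Summit.NavierStokesRegularity.NavierStokesRegularity.Theorems.GaldiLiouville.AllAxesBudget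

end
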